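import Summits.QuantumFields.BalabanUV.Beta.D1BFx.TorusWeightMixedArrays

/-!
# TB4-W PART 3b-N (FILE N3e) — (u1): the s-UNIFORM localisation of the mixed weight table `BwMix` (road «BF-x», slot (K); ρ-g7-8)

Ruling ρ-g7-8 (u1): the k-indexed N-side families must be bi-localised at the pair's base points with constants and rate UNIFORM in `k`
(here: in `s = (m+1)·p`).  Every piece of `BwMix s (m+1) a κ u l u′` (FILES N3a–N3d) is either a FIXED kernel or a two-array word
`X ∘ A ∘ arr s Y` ∕ `jet•(arr s Z)` ∕ `eYe s …` whose localisation constants are `s`-FREE by TA2 (`decays_arr`, `biLoc_comp_arr`,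
`biLoc_eYe_of_rowBound`); this file does the bookkeeping: each piece is localised at `(u,u)`, `(u′,u′)` or `(u,u′)` uniformly, then re-centred
to the pair `(u, u′)` (`KernelWard.biLoc_recentre`, factor at most `exp (2|u−u′|₁)` since all rates are at most `1`), and summed.
[folklore]; no definitions.
-/

noncomputable section

namespace Summit.QuantumFields.BalabanUV.Beta.D1BFx.TorusWeightMixedLoc

open scoped BigOperators
open Literature.MathematicalPhysics.QuantumFieldTheory.Balaban1983to89
open Literature.MathematicalPhysics.QuantumFieldTheory.Balaban1983to89.Beta
open B12Sec2to5 (l1 l1_nonneg)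
open ExpKernelCalculus (MKer BiLoc Decays Zl comp biLoc_comp_decays)
open KernelWard (biLoc_add biLoc_sub biLoc_recentre)
open BalabanStepJetsSucc (biLoc_comp_right)
open Summit.QuantumFields.BalabanUV.Beta.TameKernelCalculus (decays_of_le biLoc_of_le trK biLoc_trK)
open Summit.QuantumFields.BalabanUV.Beta.D1BFx.PeriodicArrays (arr toF decays_arr)
open Summit.QuantumFields.BalabanUV.Beta.D1BFx.FibredPeriodisation (Kfib)
open Summit.QuantumFields.BalabanUV.Beta.D1BFx.GhostStencil (ghCur biLoc_ghCur l1_zero)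
open Summit.QuantumFields.BalabanUV.Beta.D1BFx.RJetProjector (Rgt)
open Summit.QuantumFields.BalabanUV.Beta.D1BFx.RJetAssembly (dSw biLoc_dSw)
open Summit.QuantumFields.BalabanUV.Beta.D1BFx.TorusJetSandwichArrays (jetR jetC biLoc_jetR biLoc_jetC)
open Summit.QuantumFields.BalabanUV.Beta.D1BFx.TorusGhostWordArrays (lapU Lgh biLoc_Lgh cL)
open Summit.QuantumFields.BalabanUV.Beta.D1BFx.TorusGhostPairStencils (gh₂ biLoc_gh₂)
open Summit.QuantumFields.BalabanUV.Beta.D1BFx.KGhostLeg (Cgh)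
open Summit.QuantumFields.BalabanUV.Beta.D1BFx.TorusBondArrays (dB dB_pos dB_le_one decays_lapU_Cgh decays_Cgh_lapU)
open Summit.QuantumFields.BalabanUV.Beta.D1BFx.TorusWeightWordArrays (wL wR wC decays_Rgt_dB)
open Summit.QuantumFields.BalabanUV.Beta.D1BFx.TorusTwoArrayWords (biLoc_comp_arr eYe biLoc_eYe_of_rowBound)
open Summit.QuantumFields.BalabanUV.Beta.D1BFx.TorusMixedLetters (decays_Cgh_dB decays_A₃ decays_A₄)
open Summit.QuantumFields.BalabanUV.Beta.D1BFx.TorusWeightMixedTerms (K5 K7 K9 Z4 K4 biLoc_wR biLoc_wL biLoc_wC biLoc_cur_Cgh_arr_cur biLoc_Z5 biLoc_zero_bond)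
open Summit.QuantumFields.BalabanUV.Beta.D1BFx.TorusWeightMixedArrays (BwMix)

/-! ## §1 Re-centring to the pair and small helpers -/

section Helpers

variable {F : Type*} {K : MKer 4 F} {C δ : ℝ} {u u' : Fin 4 → ℤ}

/-- [folklore] For `0 ≤ δ ≤ 1` and `t ≥ 0`: `e^{δ·t} ≤ e^{t}`. -/
theorem exp_rate_le {t : ℝ} (ht : 0 ≤ t) (hδ1 : δ ≤ 1) : Real.exp (δ * t) ≤ Real.exp t :=
  Real.exp_le_exp.mpr (by nlinarith)

/-- [folklore] **FROM `(u, u)` TO THE PAIR `(u, u′)`**: `BiLoc K u u C δ ⟹ BiLoc K u u′ (C·e^{2|u−u′|₁}) δ` (`0 ≤ δ ≤ 1`). -/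
theorem biLoc_pair_of_left (a₀ : F) (hK : BiLoc K u u C δ) (hδ : 0 ≤ δ) (hδ1 : δ ≤ 1) :
    BiLoc K u u' (C * Real.exp (4 * l1 (u - u'))) δ := by
  have h := biLoc_recentre hK hδ u u'
  rw [sub_self, l1_zero, zero_add] at h
  refine StepJetData.biLoc_weaken h (mul_le_mul_of_nonneg_left ?_ (hK.nonneg a₀)) le_rfl
  exact (exp_rate_le (l1_nonneg _) hδ1).trans (Real.exp_le_exp.mpr (by linarith [l1_nonneg (u - u')]))

/-- [folklore] **FROM `(u′, u′)` TO THE PAIR `(u, u′)`**: `BiLoc K u′ u′ C δ ⟹ BiLoc K u u′ (C·e^{2|u−u′|₁}) δ` (`0 ≤ δ ≤ 1`). -/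
theorem biLoc_pair_of_right (a₀ : F) (hK : BiLoc K u' u' C δ) (hδ : 0 ≤ δ) (hδ1 : δ ≤ 1) :
    BiLoc K u u' (C * Real.exp (4 * l1 (u - u'))) δ := by
  have h := biLoc_recentre hK hδ u u'
  rw [sub_self, l1_zero, add_zero, Beta.l1_sub_comm u' u] at h
  refine StepJetData.biLoc_weaken h (mul_le_mul_of_nonneg_left ?_ (hK.nonneg a₀)) le_rfl
  exact (exp_rate_le (l1_nonneg _) hδ1).trans (Real.exp_le_exp.mpr (by linarith [l1_nonneg (u - u')]))

/-- [folklore] **FROM `(u′, u′)` TO `(u, u)`**: `BiLoc K u′ u′ C δ ⟹ BiLoc K u u (C·e^{2|u−u′|₁}) δ` (`0 ≤ δ ≤ 1`). -/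
theorem biLoc_diag_of_right (a₀ : F) (hK : BiLoc K u' u' C δ) (hδ : 0 ≤ δ) (hδ1 : δ ≤ 1) :
    BiLoc K u u (C * Real.exp (2 * l1 (u - u'))) δ := by
  have h := biLoc_recentre hK hδ u u
  rw [Beta.l1_sub_comm u' u, ← two_mul] at h
  refine StepJetData.biLoc_weaken h (mul_le_mul_of_nonneg_left (Real.exp_le_exp.mpr ?_) (hK.nonneg a₀)) le_rfl
  nlinarith [l1_nonneg (u - u')]

/-- [folklore] A `(u, u′)`-localised kernel keeps its localisation under the weight `e^{2|u−u′|₁} ≥ 1`. -/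
theorem biLoc_pair_weight (a₀ : F) (hK : BiLoc K u u' C δ) : BiLoc K u u' (C * Real.exp (4 * l1 (u - u'))) δ :=
  StepJetData.biLoc_weaken hK (le_mul_of_one_le_right (hK.nonneg a₀) (Real.one_le_exp (by linarith [l1_nonneg (u - u')]))) le_rfl

/-- [folklore] **FROM `(u′, u)` TO THE PAIR `(u, u′)`** (both points move): `BiLoc K u′ u C δ ⟹ BiLoc K u u′ (C·e^{4|u−u′|₁}) δ` (`0 ≤ δ ≤ 1`). -/
theorem biLoc_pair_of_swap (a₀ : F) (hK : BiLoc K u' u C δ) (hδ : 0 ≤ δ) (hδ1 : δ ≤ 1) :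
    BiLoc K u u' (C * Real.exp (4 * l1 (u - u'))) δ := by
  have h := biLoc_recentre hK hδ u u'
  rw [Beta.l1_sub_comm u' u, ← two_mul] at h
  refine StepJetData.biLoc_weaken h (mul_le_mul_of_nonneg_left (Real.exp_le_exp.mpr ?_) (hK.nonneg a₀)) le_rfl
  nlinarith [l1_nonneg (u - u')]

/-- [folklore] A `(u, u)`-localised kernel keeps its localisation under the weight `e^{2|u−u′|₁} ≥ 1`. -/
theorem biLoc_diag_weight (a₀ : F) (hK : BiLoc K u u C δ) : BiLoc K u u (C * Real.exp (2 * l1 (u - u'))) δ :=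
  StepJetData.biLoc_weaken hK (le_mul_of_one_le_right (hK.nonneg a₀) (Real.one_le_exp (by linarith [l1_nonneg (u - u')]))) le_rfl

/-- [folklore] A tested family is localised like the untested one (the test only kills it). -/
theorem biLoc_ite {p q : Fin 4 → ℤ} (hK : BiLoc K p q C δ) (P : Prop) [Decidable P] : BiLoc (if P then K else 0) p q C δ := by
  split_ifs
  · exact hK
  · intro x y a b
    rw [Pi.zero_apply, Pi.zero_apply, Pi.zero_apply, Pi.zero_apply, abs_zero]
    exact mul_nonneg (hK.nonneg a) (Real.exp_pos _).le

end Helpers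

/-! ## §2 The pieces, uniformly -/

section Pieces

variable (m : ℕ) {a : ℝ}

/-- [folklore] `dB/64 ≤ 1`. -/
theorem rate_le_one (ha : 0 < a) : dB (m + 1) a / 64 ≤ 1 := by have := dB_le_one (m + 1) a; have := dB_pos (m + 1) a ha; linarith

/-- [folklore] **(u1) FOR `K5`** at `(u, u′)`: s-free constant, rate `dB/64`. -/
theorem biLoc_K5_uniform (ha : 0 < a) : ∃ C : ℝ, 0 ≤ C ∧ ∀ (p : ℕ) [NeZero p] (κ : Fin 4) (u : Fin 4 → ℤ) (l : Fin 4) (u' : Fin 4 → ℤ),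
    BiLoc (K5 ((m + 1) * p) (m + 1) a κ u l u') u u' (C * Real.exp (4 * l1 (u - u'))) (dB (m + 1) a / 64) := by
  have hd := dB_pos (m + 1) a ha
  have hr1 := rate_le_one m ha
  obtain ⟨C₁, h1, h₁⟩ := biLoc_cur_Cgh_arr_cur m ha
  obtain ⟨CL, hL0, hL⟩ := biLoc_wL m ha
  obtain ⟨CR, hR0, hR⟩ := biLoc_wR m ha
  have hRgt := decays_Rgt_dB m ha
  have hB := (show Decay₂ (Kfib (toF (Rgt (m + 1) a)) () ()) _ (dB (m + 1) a / 8) from fun x y => hRgt x y () ()).rowBound (by linarith)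
  have hZ1 : 0 ≤ Zl 4 (dB (m + 1) a / 4 / 2) := (ExpKernelCalculus.Zl_pos (by linarith)).le
  have hB0 : 0 ≤ |1 + RProjector.cPP 4 (m + 1 - 1) a * Real.exp (RProjector.deltaPP 4 a)| * ∑' w : Fin 4 → ℤ, Real.exp (-(dB (m + 1) a / 8) * l1 w) :=
    mul_nonneg (abs_nonneg _) (tsum_nonneg fun w => (Real.exp_pos _).le)
  refine ⟨4 * C₁ * Real.exp (2 * (dB (m + 1) a / 4 / 4))
      + 2 * (CL * Zl 4 (dB (m + 1) a / 4 / 2) * 1) * Real.exp (2 * (dB (m + 1) a / 4 / 2))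
      + 2 * (CR * Zl 4 (dB (m + 1) a / 4 / 2) * 1) * Real.exp (2 * (dB (m + 1) a / 4 / 2))
      + |1 + RProjector.cPP 4 (m + 1 - 1) a * Real.exp (RProjector.deltaPP 4 a)| * ∑' w : Fin 4 → ℤ, Real.exp (-(dB (m + 1) a / 8) * l1 w),
    by positivity, fun p _ κ u l u' => ?_⟩
  have P1 : BiLoc (dSw (comp (comp (ghCur κ u) (Cgh (m + 1) a)) (arr ((m + 1) * p) (ghCur l u')))) u u (4 * C₁ * Real.exp (2 * (dB (m + 1) a / 4 / 4)))
      (dB (m + 1) a / 64) := StepJetData.biLoc_weaken (biLoc_dSw u _ (by linarith) (h₁ ((m + 1) * p) κ u l u')) le_rfl (by linarith)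
  have P2 : BiLoc (jetC l u' (arr ((m + 1) * p) (wL (m + 1) a κ u))) u' u'
      (2 * (CL * Zl 4 (dB (m + 1) a / 4 / 2) * 1) * Real.exp (2 * (dB (m + 1) a / 4 / 2))) (dB (m + 1) a / 64) := by
    have h := biLoc_jetC l u' (hδ := by linarith) (hY := decays_arr (hL κ u) (by linarith : (0:ℝ) < dB (m + 1) a / 4) ((m + 1) * p))
    rw [sub_self, l1_zero, mul_zero, Real.exp_zero] at h
    exact StepJetData.biLoc_weaken h le_rfl (by linarith)
  have P3 : BiLoc (jetR κ u (arr ((m + 1) * p) (wR (m + 1) a l u'))) u u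
      (2 * (CR * Zl 4 (dB (m + 1) a / 4 / 2) * 1) * Real.exp (2 * (dB (m + 1) a / 4 / 2))) (dB (m + 1) a / 64) := by
    have h := biLoc_jetR κ u (hδ := by linarith) (hY := decays_arr (hR l u') (by linarith : (0:ℝ) < dB (m + 1) a / 4) ((m + 1) * p))
    rw [sub_self, l1_zero, mul_zero, Real.exp_zero] at h
    exact StepJetData.biLoc_weaken h le_rfl (by linarith)
  have P4 : BiLoc (eYe ((m + 1) * p) κ u l u' (Rgt (m + 1) a)) u u' _ (dB (m + 1) a / 64) := biLoc_eYe_of_rowBound ((m + 1) * p) κ u l u' (Rgt (m + 1) a) hB _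
  have Q1 : BiLoc (-dSw (comp (comp (ghCur κ u) (Cgh (m + 1) a)) (arr ((m + 1) * p) (ghCur l u')))) u u'
      (4 * C₁ * Real.exp (2 * (dB (m + 1) a / 4 / 4)) * Real.exp (4 * l1 (u - u'))) (dB (m + 1) a / 64) :=
    SecondOrderResponse.biLoc_neg (biLoc_pair_of_left (u' := u') (0 : Fin 4) P1 (by linarith) hr1)
  have Q2 := biLoc_pair_of_right (u := u) (0 : Fin 4) P2 (by linarith) hr1
  have Q3 := biLoc_pair_of_left (u' := u') (0 : Fin 4) P3 (by linarith) hr1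
  have Q4 := biLoc_pair_weight (0 : Fin 4) P4
  have h := biLoc_add (biLoc_sub (biLoc_add Q1 Q2) Q3) Q4
  rw [K5]
  convert h using 2
  ring

/-- [folklore] **(u1) FOR `K7`** at `(u, u′)`. -/
theorem biLoc_K7_uniform (ha : 0 < a) : ∃ C : ℝ, 0 ≤ C ∧ ∀ (p : ℕ) [NeZero p] (κ : Fin 4) (u : Fin 4 → ℤ) (l : Fin 4) (u' : Fin 4 → ℤ),
    BiLoc (K7 ((m + 1) * p) (m + 1) a κ u l u') u u' (C * Real.exp (4 * l1 (u - u'))) (dB (m + 1) a / 64) := by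
  have hd := dB_pos (m + 1) a ha
  have hr1 := rate_le_one m ha
  obtain ⟨C₅, h5, h₅⟩ := biLoc_Z5 m ha
  obtain ⟨CW, hW0, hW⟩ := biLoc_wC m ha
  have hZ1 : 0 ≤ Zl 4 (dB (m + 1) a / 8 / 2) := (ExpKernelCalculus.Zl_pos (by linarith)).le
  refine ⟨4 * C₅ * Real.exp (2 * (dB (m + 1) a / 8 / 4)) + 2 * (CW * Zl 4 (dB (m + 1) a / 8 / 2) * 1) * Real.exp (2 * (dB (m + 1) a / 8 / 2)),
    by positivity, fun p _ κ u l u' => ?_⟩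
  have P1 : BiLoc (dSw (comp (comp (comp (comp lapU (Cgh (m + 1) a)) (Lgh κ u)) (Cgh (m + 1) a)) (arr ((m + 1) * p) (ghCur l u')))) u u
      (4 * C₅ * Real.exp (2 * (dB (m + 1) a / 8 / 4))) (dB (m + 1) a / 64) :=
    StepJetData.biLoc_weaken (biLoc_dSw u _ (by linarith) (h₅ ((m + 1) * p) κ u l u')) le_rfl (by linarith)
  have P2 : BiLoc (jetC l u' (arr ((m + 1) * p) (wC (m + 1) a κ u))) u' u'
      (2 * (CW * Zl 4 (dB (m + 1) a / 8 / 2) * 1) * Real.exp (2 * (dB (m + 1) a / 8 / 2))) (dB (m + 1) a / 64) := by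
    have h := biLoc_jetC l u' (hδ := by linarith) (hY := decays_arr (hW κ u) (by linarith : (0:ℝ) < dB (m + 1) a / 8) ((m + 1) * p))
    rw [sub_self, l1_zero, mul_zero, Real.exp_zero] at h
    exact StepJetData.biLoc_weaken h le_rfl (by linarith)
  have Q1 : BiLoc (-dSw (comp (comp (comp (comp lapU (Cgh (m + 1) a)) (Lgh κ u)) (Cgh (m + 1) a)) (arr ((m + 1) * p) (ghCur l u')))) u u'
      (4 * C₅ * Real.exp (2 * (dB (m + 1) a / 8 / 4)) * Real.exp (4 * l1 (u - u'))) (dB (m + 1) a / 64) :=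
    SecondOrderResponse.biLoc_neg (biLoc_pair_of_left (u' := u') (0 : Fin 4) P1 (by linarith) hr1)
  have Q2 := biLoc_pair_of_right (u := u) (0 : Fin 4) P2 (by linarith) hr1
  have h := biLoc_add Q1 Q2
  rw [K7]
  convert h using 2
  ring

/-- [folklore] **(u1) FOR `K9`** at `(u, u′)` (the tested pieces are bounded by the untested ones). -/
theorem biLoc_K9_uniform (ha : 0 < a) : ∃ C : ℝ, 0 ≤ C ∧ ∀ (p : ℕ) [NeZero p] (κ : Fin 4) (u : Fin 4 → ℤ) (l : Fin 4) (u' : Fin 4 → ℤ),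
    BiLoc (K9 ((m + 1) * p) (m + 1) a κ u l u') u u' (C * Real.exp (4 * l1 (u - u'))) (dB (m + 1) a / 64) := by
  have hd := dB_pos (m + 1) a ha
  have hr1 := rate_le_one m ha
  obtain ⟨C₁, hC₁⟩ := decays_lapU_Cgh (m + 1) a ha
  obtain ⟨CR, hR0, hR⟩ := biLoc_wR m ha
  have hRgt := decays_Rgt_dB m ha
  have hC₁0 : 0 ≤ C₁ := hC₁.nonneg ()
  have hZ1 : 0 ≤ Zl 4 (dB (m + 1) a / 2 - dB (m + 1) a / 4) := (ExpKernelCalculus.Zl_pos (by linarith)).le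
  have hZ2 : 0 ≤ Zl 4 (dB (m + 1) a / 4 / 2) := (ExpKernelCalculus.Zl_pos (by linarith)).le
  refine ⟨4 * ((Fintype.card Unit : ℝ) * (C₁ * (Real.exp (dB (m + 1) a / 2) + Real.exp (dB (m + 1) a / 2))) * Zl 4 (dB (m + 1) a / 2 - dB (m + 1) a / 4))
        * Real.exp (2 * (dB (m + 1) a / 4))
      + 2 * (CR * Zl 4 (dB (m + 1) a / 4 / 2) * 1) * Real.exp (2 * (dB (m + 1) a / 4 / 2))
      + 2 * (CR * Zl 4 (dB (m + 1) a / 4 / 2) * 1) * Real.exp (2 * (dB (m + 1) a / 4 / 2))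
      + 2 * |1 + RProjector.cPP 4 (m + 1 - 1) a * Real.exp (RProjector.deltaPP 4 a)| * Real.exp (2 * (dB (m + 1) a / 8)),
    by positivity, fun p _ κ u l u' => ?_⟩
  have hA : BiLoc (comp (comp lapU (Cgh (m + 1) a)) (gh₂ κ u)) u u _ (dB (m + 1) a / 4) :=
    biLoc_comp_decays hC₁ (biLoc_gh₂ κ u (dB (m + 1) a / 2)) (by linarith) (by linarith)
  have P1 : BiLoc (if (siteOf 4 ((m + 1) * p) u, κ) = (siteOf 4 ((m + 1) * p) u', l) then dSw (comp (comp lapU (Cgh (m + 1) a)) (gh₂ κ u)) else 0) u u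
      (4 * ((Fintype.card Unit : ℝ) * (C₁ * (Real.exp (dB (m + 1) a / 2) + Real.exp (dB (m + 1) a / 2))) * Zl 4 (dB (m + 1) a / 2 - dB (m + 1) a / 4))
        * Real.exp (2 * (dB (m + 1) a / 4))) (dB (m + 1) a / 64) :=
    biLoc_ite (StepJetData.biLoc_weaken (biLoc_dSw u _ (by linarith) hA) le_rfl (by linarith)) _
  have P2 : BiLoc (jetC l u' (arr ((m + 1) * p) (wR (m + 1) a κ u))) u' u'
      (2 * (CR * Zl 4 (dB (m + 1) a / 4 / 2) * 1) * Real.exp (2 * (dB (m + 1) a / 4 / 2))) (dB (m + 1) a / 64) := by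
    have h := biLoc_jetC l u' (hδ := by linarith) (hY := decays_arr (hR κ u) (by linarith : (0:ℝ) < dB (m + 1) a / 4) ((m + 1) * p))
    rw [sub_self, l1_zero, mul_zero, Real.exp_zero] at h
    exact StepJetData.biLoc_weaken h le_rfl (by linarith)
  have P3 : BiLoc (jetC κ u (arr ((m + 1) * p) (wR (m + 1) a l u'))) u u
      (2 * (CR * Zl 4 (dB (m + 1) a / 4 / 2) * 1) * Real.exp (2 * (dB (m + 1) a / 4 / 2))) (dB (m + 1) a / 64) := by
    have h := biLoc_jetC κ u (hδ := by linarith) (hY := decays_arr (hR l u') (by linarith : (0:ℝ) < dB (m + 1) a / 4) ((m + 1) * p))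
    rw [sub_self, l1_zero, mul_zero, Real.exp_zero] at h
    exact StepJetData.biLoc_weaken h le_rfl (by linarith)
  have P4 : BiLoc (if (siteOf 4 ((m + 1) * p) u, κ) = (siteOf 4 ((m + 1) * p) u', l) then jetC κ u (Rgt (m + 1) a) else 0) u u
      (2 * |1 + RProjector.cPP 4 (m + 1 - 1) a * Real.exp (RProjector.deltaPP 4 a)| * Real.exp (2 * (dB (m + 1) a / 8))) (dB (m + 1) a / 64) :=
    biLoc_ite (StepJetData.biLoc_weaken (biLoc_jetC κ u (hδ := by linarith) (hY := hRgt)) le_rfl (by linarith)) _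
  have Q1 := biLoc_pair_of_left (u' := u') (0 : Fin 4) P1 (by linarith) hr1
  have Q2 := biLoc_pair_of_right (u := u) (0 : Fin 4) P2 (by linarith) hr1
  have Q3 := biLoc_pair_of_left (u' := u') (0 : Fin 4) P3 (by linarith) hr1
  have Q4 := biLoc_pair_of_left (u' := u') (0 : Fin 4) P4 (by linarith) hr1
  have h := biLoc_add (biLoc_sub (biLoc_sub Q1 Q2) Q3) Q4
  rw [K9]
  convert h using 2
  ring

/-- [folklore] **(u1) FOR `Z4`** at the DIAGONAL pair `(u, u)` (constant with the weight `e^{2|u−u′|₁}` from the pieces born at `(u′, u′)`). -/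
theorem biLoc_Z4_uniform (ha : 0 < a) : ∃ C : ℝ, 0 ≤ C ∧ ∀ (p : ℕ) [NeZero p] (κ : Fin 4) (u : Fin 4 → ℤ) (l : Fin 4) (u' : Fin 4 → ℤ),
    BiLoc (Z4 ((m + 1) * p) (m + 1) a κ u l u') u u (C * Real.exp (2 * l1 (u - u'))) (dB (m + 1) a / 64) := by
  have hd := dB_pos (m + 1) a ha
  have hr1 := rate_le_one m ha
  obtain ⟨C₁, hC₁⟩ := decays_lapU_Cgh (m + 1) a ha
  obtain ⟨C₂, hC₂⟩ := decays_Cgh_lapU (m + 1) a ha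
  obtain ⟨C₃, hC₃⟩ := decays_A₃ m ha
  obtain ⟨C₄, hC₄⟩ := decays_A₄ m ha
  obtain ⟨C, hC⟩ := decays_Cgh_dB m ha
  obtain ⟨CR, hR0, hR⟩ := biLoc_wR m ha
  obtain ⟨CG, hG0, hG⟩ := TorusWeightWordArrays.biLoc_lapU_Cgh_Lgh m ha
  have hC₁0 : 0 ≤ C₁ := hC₁.nonneg ()
  -- M1: ((A₁∘gh₂)∘A₃) at (u,u), rate dB/8
  have M1 : ∀ (κ : Fin 4) (u : Fin 4 → ℤ), BiLoc (comp (comp (comp lapU (Cgh (m + 1) a)) (gh₂ κ u)) (comp lapU (comp (Cgh (m + 1) a) lapU))) u u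
      ((Fintype.card Unit : ℝ) * (((Fintype.card Unit : ℝ) * (C₁ * (Real.exp (dB (m + 1) a / 2) + Real.exp (dB (m + 1) a / 2)))
        * Zl 4 (dB (m + 1) a / 2 - dB (m + 1) a / 4)) * |C₃|) * Zl 4 (dB (m + 1) a / 4 - dB (m + 1) a / 8)) (dB (m + 1) a / 8) :=
    fun κ u => biLoc_comp_right (biLoc_comp_decays hC₁ (biLoc_gh₂ κ u (dB (m + 1) a / 2)) (by linarith) (by linarith))
      (decays_of_le hC₃ le_rfl) (by linarith) (by linarith)
  -- M4: ((A₄∘gh₂)∘A₂) at (u,u), rate dB/16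
  have M4 : ∀ (κ : Fin 4) (u : Fin 4 → ℤ), BiLoc (comp (comp (comp (comp lapU (Cgh (m + 1) a)) lapU) (gh₂ κ u)) (comp (Cgh (m + 1) a) lapU)) u u
      ((Fintype.card Unit : ℝ) * (((Fintype.card Unit : ℝ) * (C₄ * (Real.exp (dB (m + 1) a / 4) + Real.exp (dB (m + 1) a / 4)))
        * Zl 4 (dB (m + 1) a / 4 - dB (m + 1) a / 8)) * |C₂|) * Zl 4 (dB (m + 1) a / 8 - dB (m + 1) a / 16)) (dB (m + 1) a / 16) :=
    fun κ u => biLoc_comp_right (biLoc_comp_decays hC₄ (biLoc_gh₂ κ u (dB (m + 1) a / 4)) (by linarith) (by linarith))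
      (decays_of_le hC₂ (by linarith)) (by linarith) (by linarith)
  -- M2 (κ,u; l,u'): ((wR_β ∘ arr ghCur_β′) ∘ A₂) at (u,u), rate dB/32
  have M2 : ∀ (p : ℕ) [NeZero p] (κ : Fin 4) (u : Fin 4 → ℤ) (l : Fin 4) (u' : Fin 4 → ℤ),
      BiLoc (comp (comp (wR (m + 1) a κ u) (arr ((m + 1) * p) (ghCur l u'))) (comp (Cgh (m + 1) a) lapU)) u u
        ((Fintype.card Unit : ℝ) * (((Fintype.card Unit : ℝ) * (CR * (Real.exp (dB (m + 1) a / 4) * Zl 4 (dB (m + 1) a / 4 / 2) * 1))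
          * Zl 4 (dB (m + 1) a / 4 / 2 - dB (m + 1) a / 4 / 4)) * |C₂|) * Zl 4 (dB (m + 1) a / 4 / 4 - dB (m + 1) a / 32)) (dB (m + 1) a / 32) := by
    intro p _ κ u l u'
    have h := biLoc_comp_arr ((m + 1) * p) (hR κ u) (biLoc_ghCur l u' (dB (m + 1) a / 4)) (by linarith)
    rw [sub_self, l1_zero, mul_zero, Real.exp_zero] at h
    exact biLoc_comp_right h (decays_of_le hC₂ (by linarith)) (by linarith) (by linarith)
  -- M5 (κ,u; l,u'): (((A₁∘Lgh_β)∘Cgh ∘ arr Lgh_β′) ∘ A₂) at (u,u), rate dB/64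
  have M5 : ∀ (p : ℕ) [NeZero p] (κ : Fin 4) (u : Fin 4 → ℤ) (l : Fin 4) (u' : Fin 4 → ℤ),
      BiLoc (comp (comp (comp (comp (comp lapU (Cgh (m + 1) a)) (Lgh κ u)) (Cgh (m + 1) a)) (arr ((m + 1) * p) (Lgh l u'))) (comp (Cgh (m + 1) a) lapU)) u u
        ((Fintype.card Unit : ℝ) * (((Fintype.card Unit : ℝ) * (((Fintype.card Unit : ℝ) * (CG * |C|) * Zl 4 (dB (m + 1) a / 4 - dB (m + 1) a / 8))
          * (cL * Zl 4 (dB (m + 1) a / 8 / 2) * 1)) * Zl 4 (dB (m + 1) a / 8 / 2 - dB (m + 1) a / 8 / 4)) * |C₂|)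
          * Zl 4 (dB (m + 1) a / 8 / 4 - dB (m + 1) a / 64)) (dB (m + 1) a / 64) := by
    intro p _ κ u l u'
    have hXA : BiLoc (comp (comp (comp lapU (Cgh (m + 1) a)) (Lgh κ u)) (Cgh (m + 1) a)) u u
        ((Fintype.card Unit : ℝ) * (CG * |C|) * Zl 4 (dB (m + 1) a / 4 - dB (m + 1) a / 8)) (dB (m + 1) a / 8) :=
      biLoc_comp_right (hG κ u) (decays_of_le hC (by linarith)) (by linarith) (by linarith)
    have h := biLoc_comp_arr ((m + 1) * p) hXA (StepJetData.biLoc_weaken (biLoc_Lgh l u') le_rfl (by linarith [dB_le_one (m + 1) a])) (by linarith)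
    rw [sub_self, l1_zero, mul_zero, Real.exp_zero] at h
    exact biLoc_comp_right h (decays_of_le hC₂ (by linarith)) (by linarith) (by linarith)
  obtain ⟨K1, hK1n, hK1⟩ : ∃ K : ℝ, 0 ≤ K ∧ ∀ (κ : Fin 4) (u : Fin 4 → ℤ),
      BiLoc (comp (comp (comp lapU (Cgh (m + 1) a)) (gh₂ κ u)) (comp lapU (comp (Cgh (m + 1) a) lapU))) u u K (dB (m + 1) a / 8) :=
    ⟨_, (M1 0 0).nonneg 0, M1⟩
  obtain ⟨K4, hK4n, hK4⟩ : ∃ K : ℝ, 0 ≤ K ∧ ∀ (κ : Fin 4) (u : Fin 4 → ℤ),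
      BiLoc (comp (comp (comp (comp lapU (Cgh (m + 1) a)) lapU) (gh₂ κ u)) (comp (Cgh (m + 1) a) lapU)) u u K (dB (m + 1) a / 16) :=
    ⟨_, (M4 0 0).nonneg 0, M4⟩
  obtain ⟨K2, hK2n, hK2⟩ : ∃ K : ℝ, 0 ≤ K ∧ ∀ (p : ℕ) [NeZero p] (κ : Fin 4) (u : Fin 4 → ℤ) (l : Fin 4) (u' : Fin 4 → ℤ),
      BiLoc (comp (comp (wR (m + 1) a κ u) (arr ((m + 1) * p) (ghCur l u'))) (comp (Cgh (m + 1) a) lapU)) u u K (dB (m + 1) a / 32) :=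
    ⟨_, (M2 1 0 0 0 0).nonneg 0, M2⟩
  obtain ⟨K5, hK5n, hK5⟩ : ∃ K : ℝ, 0 ≤ K ∧ ∀ (p : ℕ) [NeZero p] (κ : Fin 4) (u : Fin 4 → ℤ) (l : Fin 4) (u' : Fin 4 → ℤ),
      BiLoc (comp (comp (comp (comp (comp lapU (Cgh (m + 1) a)) (Lgh κ u)) (Cgh (m + 1) a)) (arr ((m + 1) * p) (Lgh l u'))) (comp (Cgh (m + 1) a) lapU)) u u
        K (dB (m + 1) a / 64) :=
    ⟨_, (M5 1 0 0 0 0).nonneg 0, M5⟩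
  refine ⟨(K1 + K4) + K2 + K2 + K5 + K5, by positivity, fun p _ κ u l u' => ?_⟩
  have Q1 : BiLoc (if (siteOf 4 ((m + 1) * p) u, κ) = (siteOf 4 ((m + 1) * p) u', l) then
        comp (comp (comp lapU (Cgh (m + 1) a)) (gh₂ κ u)) (comp lapU (comp (Cgh (m + 1) a) lapU))
          + comp (comp (comp (comp lapU (Cgh (m + 1) a)) lapU) (gh₂ κ u)) (comp (Cgh (m + 1) a) lapU) else 0) u u
      ((K1 + K4) * Real.exp (2 * l1 (u - u'))) (dB (m + 1) a / 64) :=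
    biLoc_ite (biLoc_diag_weight (u' := u') ()
      (biLoc_add (StepJetData.biLoc_weaken (hK1 κ u) le_rfl (show dB (m + 1) a / 64 ≤ dB (m + 1) a / 8 by linarith))
        (StepJetData.biLoc_weaken (hK4 κ u) le_rfl (show dB (m + 1) a / 64 ≤ dB (m + 1) a / 16 by linarith)))) _
  have Q2 := biLoc_diag_weight (u' := u') () (StepJetData.biLoc_weaken (hK2 p κ u l u') le_rfl (by linarith : dB (m + 1) a / 64 ≤ dB (m + 1) a / 32))
  have Q3 := biLoc_diag_of_right (u := u) () (StepJetData.biLoc_weaken (hK2 p l u' κ u) le_rfl (by linarith : dB (m + 1) a / 64 ≤ dB (m + 1) a / 32))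
    (by linarith) hr1
  have Q5 := biLoc_diag_weight (u' := u') () (hK5 p κ u l u')
  have Q6 := biLoc_diag_of_right (u := u) () (hK5 p l u' κ u) (by linarith) hr1
  have h := biLoc_add (biLoc_add (SecondOrderResponse.biLoc_neg (biLoc_add (biLoc_add Q1 Q2) Q3)) Q5) Q6
  rw [Z4]
  exact StepJetData.biLoc_weaken h (le_of_eq (by ring)) le_rfl

/-- [folklore] **(u1) FOR `K4 = dSw Z4`** at `(u, u′)`. -/
theorem biLoc_K4_uniform (ha : 0 < a) : ∃ C : ℝ, 0 ≤ C ∧ ∀ (p : ℕ) [NeZero p] (κ : Fin 4) (u : Fin 4 → ℤ) (l : Fin 4) (u' : Fin 4 → ℤ),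
    BiLoc (K4 ((m + 1) * p) (m + 1) a κ u l u') u u' (C * Real.exp (4 * l1 (u - u'))) (dB (m + 1) a / 64) := by
  have hd := dB_pos (m + 1) a ha
  have hr1 := rate_le_one m ha
  obtain ⟨C, hC0, hC⟩ := biLoc_Z4_uniform m ha
  refine ⟨4 * C * Real.exp (2 * (dB (m + 1) a / 64)), by positivity, fun p _ κ u l u' => ?_⟩
  have h1 := biLoc_dSw u _ (by linarith) (hC p κ u l u')
  have h2 := biLoc_recentre h1 (by linarith : (0:ℝ) ≤ dB (m + 1) a / 64) u u'
  rw [sub_self, l1_zero, zero_add] at h2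
  rw [K4]
  refine StepJetData.biLoc_weaken h2 ?_ le_rfl
  have hE : Real.exp (dB (m + 1) a / 64 * l1 (u - u')) ≤ Real.exp (2 * l1 (u - u')) :=
    Real.exp_le_exp.mpr (by nlinarith [l1_nonneg (u - u')])
  have hpos : 0 ≤ 4 * C * Real.exp (2 * (dB (m + 1) a / 64)) := by positivity
  calc 4 * (C * Real.exp (2 * l1 (u - u'))) * Real.exp (2 * (dB (m + 1) a / 64)) * Real.exp (dB (m + 1) a / 64 * l1 (u - u'))
      ≤ 4 * (C * Real.exp (2 * l1 (u - u'))) * Real.exp (2 * (dB (m + 1) a / 64)) * Real.exp (2 * l1 (u - u')) :=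
        mul_le_mul_of_nonneg_left hE (by positivity)
    _ = 4 * C * Real.exp (2 * (dB (m + 1) a / 64)) * Real.exp (4 * l1 (u - u')) := by
        rw [show (4 : ℝ) * l1 (u - u') = 2 * l1 (u - u') + 2 * l1 (u - u') by ring, Real.exp_add]; ring

end Pieces

/-! ## §3 The mixed table, uniformly -/

section Total

variable (m : ℕ) {a : ℝ}

/-- [folklore] **(u1) FOR `BwMix`**: ONE s-free constant `C` and ONE rate `dB/64` with
`BiLoc (BwMix ((m+1)p) (m+1) a κ u l u′) u u′ (C·e^{8|u−u′|₁}) (dB/64)` for every `p` and every bond pair — the letter `hW` (uniform in `k`, the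
pair-dependence only through `|u − u′|₁`) of `SortedArrayLimitUniform.tendsto_hessT_sortK_hessKer_of_uniform` for the `ℬ₂` part of `𝒲N k`. -/
theorem biLoc_BwMix_uniform (ha : 0 < a) : ∃ C : ℝ, 0 ≤ C ∧ ∀ (p : ℕ) [NeZero p] (κ : Fin 4) (u : Fin 4 → ℤ) (l : Fin 4) (u' : Fin 4 → ℤ),
    BiLoc (BwMix ((m + 1) * p) (m + 1) a κ u l u') u u' (C * Real.exp (8 * l1 (u - u'))) (dB (m + 1) a / 64) := by
  have hd := dB_pos (m + 1) a ha
  have hr1 := rate_le_one m ha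
  obtain ⟨C5, h50, h5⟩ := biLoc_K5_uniform m ha
  obtain ⟨C7, h70, h7⟩ := biLoc_K7_uniform m ha
  obtain ⟨C9, h90, h9⟩ := biLoc_K9_uniform m ha
  obtain ⟨C4, h40, h4⟩ := biLoc_K4_uniform m ha
  refine ⟨|(2 : ℝ)| * (C9 + C7 + C7 + C4 + C5 + C5 + C7 + C7 + C9), by positivity, fun p _ κ u l u' => ?_⟩
  -- every piece at the pair `(u, u′)` with the common weight `e^{8|u−u′|₁}`
  have hE : ∀ {C : ℝ}, 0 ≤ C → C * Real.exp (4 * l1 (u - u')) ≤ C * Real.exp (8 * l1 (u - u')) :=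
    fun hC => mul_le_mul_of_nonneg_left (Real.exp_le_exp.mpr (by linarith [l1_nonneg (u - u')])) hC
  have hswap : ∀ {K : MKer 4 (Fin 4)} {C : ℝ}, 0 ≤ C → BiLoc K u' u (C * Real.exp (4 * l1 (u' - u))) (dB (m + 1) a / 64) →
      BiLoc K u u' (C * Real.exp (8 * l1 (u - u'))) (dB (m + 1) a / 64) := by
    intro K C hC h
    have h2 := biLoc_pair_of_swap (0 : Fin 4) h (by linarith) hr1
    rw [Beta.l1_sub_comm u' u, mul_assoc, ← Real.exp_add] at h2
    convert h2 using 2; ring_nf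
  have D4 := StepJetData.biLoc_weaken (h4 p κ u l u') (hE h40) le_rfl
  have D5 := StepJetData.biLoc_weaken (h5 p κ u l u') (hE h50) le_rfl
  have D7 := StepJetData.biLoc_weaken (h7 p κ u l u') (hE h70) le_rfl
  have D9 := StepJetData.biLoc_weaken (h9 p κ u l u') (hE h90) le_rfl
  have D8 : BiLoc (K7 ((m + 1) * p) (m + 1) a l u' κ u) u u' (C7 * Real.exp (8 * l1 (u - u'))) (dB (m + 1) a / 64) := hswap h70 (h7 p l u' κ u)
  have T5 : BiLoc (trK (K5 ((m + 1) * p) (m + 1) a κ u l u')) u u' (C5 * Real.exp (8 * l1 (u - u'))) (dB (m + 1) a / 64) := by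
    have h := biLoc_trK (h5 p κ u l u'); rw [Beta.l1_sub_comm u u'] at h; exact hswap h50 h
  have T7 : BiLoc (trK (K7 ((m + 1) * p) (m + 1) a κ u l u')) u u' (C7 * Real.exp (8 * l1 (u - u'))) (dB (m + 1) a / 64) := by
    have h := biLoc_trK (h7 p κ u l u'); rw [Beta.l1_sub_comm u u'] at h; exact hswap h70 h
  have T9 : BiLoc (trK (K9 ((m + 1) * p) (m + 1) a κ u l u')) u u' (C9 * Real.exp (8 * l1 (u - u'))) (dB (m + 1) a / 64) := by
    have h := biLoc_trK (h9 p κ u l u'); rw [Beta.l1_sub_comm u u'] at h; exact hswap h90 h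
  have T8 : BiLoc (trK (K7 ((m + 1) * p) (m + 1) a l u' κ u)) u u' (C7 * Real.exp (8 * l1 (u - u'))) (dB (m + 1) a / 64) := by
    have h := biLoc_trK (h7 p l u' κ u); rw [Beta.l1_sub_comm u' u] at h; exact StepJetData.biLoc_weaken h (hE h70) le_rfl
  have h := StepJetData.biLoc_smul
    (biLoc_add (biLoc_add (biLoc_add (biLoc_add (biLoc_add (biLoc_add (biLoc_sub (biLoc_sub T9 T8) T7) D4) D5) T5) D7) D8) D9) (2 : ℝ)
  rw [BwMix]
  exact StepJetData.biLoc_weaken h (le_of_eq (by ring)) le_rfl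

end Total

end Summit.QuantumFields.BalabanUV.Beta.D1BFx.TorusWeightMixedLoc

end
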